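import Mathlib
import Summits.Ventures.PercRepro2.SeriesHMF
import Summits.Ventures.PercRepro2.HMFSureEdge
import Summits.Ventures.PercRepro2.StarHLeafMulti

/-!
# (HMF), hence (HCOV), at the end of a pendant path `a₃ – v – u` (blind cell PercRepro2,
night-1 g15; NIGHT1-G15.md §3 — the pendant-path extension of the two-level table)

Let the mark `a₃` be a leaf with the single edge `f = {a₃, v}`, let the unmarked vertex `v` carry
exactly `f` and `f' = {v, u}`, and let every other edge at the unmarked vertex `u` join `u` to one of
`a₁, a₂, o, b` or to an unmarked leaf (a whisker).  Then (HMF) and (HCOV) hold, for every weight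
vector (`HMF_pendant_path`, `HCov_pendant_path`).  Four landed steps:

1. the SERIES REDUCTION (`SeriesCollapse.HMF_series_iff`, with the roles of the two edges chosen so
   that `f` becomes sure): `HMF p ↔ HMF p[f' ↦ p f' · p f, f ↦ 1]`;
2. the sure edge `f = {a₃, v}` RELABELS the mark `a₃` to `v` (`HMFSureEdge.HMFc_relabel_of_sure`);
3. the old `a₃` is now an unmarked leaf of the mark `v`: DELETE it (`StarH.HMF_delete_leaf`);
4. in the graph without `f` the mark `v` is a pendant at `u` by `f'`, and `u` is as in the two-level
   theorem with whiskers (`StarH.HMF_leaf_marks_whiskers`).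

This is the class «`a₃` at distance two from `u` through an unmarked vertex of degree two» of the
(HMF) table (NIGHT1-G14.md §14); the exact twin of the series identity is
`mining/night-1/g15/series_check.py`.
-/

open scoped Classical

namespace Summit.Ventures.PercRepro2

open UnionCluster CovForm

namespace StarH

section PendantPath

variable {V : Type*} {E : Type*} [Fintype E] [DecidableEq E] [Fintype V] [DecidableEq V]
  {R : Type*} [Field R] [LinearOrder R] [IsStrictOrderedRing R]

variable (ends : E → Sym2 V) (o a₁ a₂ a₃ b v u : V) (p : E → R) {f f' : E}

/-- **(HMF) AT THE END OF A PENDANT PATH `a₃ – v – u`**: `a₃` a leaf by `f = {a₃, v}`, the unmarked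
`v` of degree two by `f' = {v, u}`, every other edge at the unmarked `u` to a mark or a whisker. -/
theorem HMF_pendant_path (hp : IsProbVec p) (hff : f ≠ f') (hf : ends f = s(a₃, v))
    (hleaf : ∀ e, a₃ ∈ ends e → e = f) (hf' : ends f' = s(v, u))
    (hdeg : ∀ e, v ∈ ends e → e = f ∨ e = f')
    (hstar : ∀ e, u ∈ ends e → ends e = s(u, v) ∨ ends e = s(u, a₁) ∨ ends e = s(u, a₂) ∨
      ends e = s(u, o) ∨ ends e = s(u, b) ∨
      (∃ y, ends e = s(u, y) ∧ y ≠ u ∧ y ≠ o ∧ y ≠ a₁ ∧ y ≠ a₂ ∧ y ≠ v ∧ y ≠ b ∧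
        ∀ e', y ∈ ends e' → e' = e))
    (h3v : a₃ ≠ v) (hvu : v ≠ u) (h3o : a₃ ≠ o) (h31 : a₃ ≠ a₁) (h32 : a₃ ≠ a₂) (h3b : a₃ ≠ b)
    (hvo : v ≠ o) (hv1 : v ≠ a₁) (hv2 : v ≠ a₂) (hvb : v ≠ b) (hu1 : u ≠ a₁) (hu2 : u ≠ a₂)
    (huo : u ≠ o) (hub : u ≠ b) : HMF p ends o a₁ a₂ a₃ b := by
  -- 1. the series reduction, `f` made sure: `p'' = p[f' ↦ p f' · p f, f ↦ 1]`
  set p'' : E → R := Function.update (Function.update p f' (p f' * p f)) f 1 with hp''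
  have hf_v : ends f = s(v, a₃) := by rw [hf, Sym2.eq_swap]
  have hdeg' : ∀ e, v ∈ ends e → e = f' ∨ e = f := fun e he => (hdeg e he).symm
  have hser : HMF p'' ends o a₁ a₂ a₃ b ↔ HMF p ends o a₁ a₂ a₃ b :=
    SeriesCollapse.HMF_series_iff p hff.symm hf' hf_v hdeg' hvu h3v.symm hvo.symm hv1.symm
      hv2.symm h3v hvb.symm
  rw [← hser]
  have hp''p : IsProbVec p'' :=
    (hp.update f' (mul_nonneg (hp.nonneg f') (hp.nonneg f))
      (mul_le_one₀ (hp.le_one f') (hp.nonneg f) (hp.le_one f))).update f zero_le_one le_rfl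
  -- 2. the sure edge `f` relabels the mark `a₃` to `v`
  have h1 : p'' f = 1 := by rw [hp'', Function.update_self]
  have hrel : HMF p'' ends o a₁ a₂ a₃ b ↔ HMF p'' ends o a₁ a₂ v b := by
    unfold HMF
    rw [HMFSureEdge.HMFc_relabel_of_sure p'' ends hp''p hf h1 o a₁ a₂ b]
  rw [hrel]
  -- 3. the old `a₃` is an unmarked leaf of the mark `v`: delete it
  rw [HMF_delete_leaf ends o a₁ a₂ v b p'' hf hleaf h3v h3o h31 h32 h3v h3b]
  -- 4. the two-level theorem with whiskers: the mark `v` is a pendant at `u` by `f'`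
  refine HMF_leaf_marks_whiskers (ZeroEdges.endsR (fun e => e ≠ f) ends) o a₁ a₂ v b u
    (ZeroEdges.pR (fun e => e ≠ f) p'') (ZeroEdges.isProbVec_pR hp''p) (f := ⟨f', hff.symm⟩) hf'
    ?_ ?_ hvu hvo hv1 hv2 hvb hu1 hu2 huo hub
  · rintro ⟨e, he⟩ hv
    have hv' : v ∈ ends e := hv
    rcases hdeg e hv' with h | h
    · exact absurd h he
    · exact Subtype.ext h
  · rintro ⟨e, he⟩ hu
    have hu' : u ∈ ends e := hu
    rcases hstar e hu' with h | h | h | h | h | ⟨y, hey, hyu, hyo, hy1, hy2, hyv, hyb, hyleaf⟩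
    · exact Or.inl h
    · exact Or.inr (Or.inl h)
    · exact Or.inr (Or.inr (Or.inl h))
    · exact Or.inr (Or.inr (Or.inr (Or.inl h)))
    · exact Or.inr (Or.inr (Or.inr (Or.inr (Or.inl h))))
    · refine Or.inr (Or.inr (Or.inr (Or.inr (Or.inr ⟨y, hey, hyu, hyo, hy1, hy2, hyv, hyb, ?_⟩))))
      rintro ⟨e', he'⟩ hy
      exact Subtype.ext (hyleaf e' hy)

/-- **(HCOV) at the end of a pendant path `a₃ – v – u`.** -/
theorem HCov_pendant_path (hp : IsProbVec p) (hff : f ≠ f') (hf : ends f = s(a₃, v))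
    (hleaf : ∀ e, a₃ ∈ ends e → e = f) (hf' : ends f' = s(v, u))
    (hdeg : ∀ e, v ∈ ends e → e = f ∨ e = f')
    (hstar : ∀ e, u ∈ ends e → ends e = s(u, v) ∨ ends e = s(u, a₁) ∨ ends e = s(u, a₂) ∨
      ends e = s(u, o) ∨ ends e = s(u, b) ∨
      (∃ y, ends e = s(u, y) ∧ y ≠ u ∧ y ≠ o ∧ y ≠ a₁ ∧ y ≠ a₂ ∧ y ≠ v ∧ y ≠ b ∧
        ∀ e', y ∈ ends e' → e' = e))
    (h3v : a₃ ≠ v) (hvu : v ≠ u) (h3o : a₃ ≠ o) (h31 : a₃ ≠ a₁) (h32 : a₃ ≠ a₂) (h3b : a₃ ≠ b)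
    (hvo : v ≠ o) (hv1 : v ≠ a₁) (hv2 : v ≠ a₂) (hvb : v ≠ b) (hu1 : u ≠ a₁) (hu2 : u ≠ a₂)
    (huo : u ≠ o) (hub : u ≠ b) : HCov p ends o a₁ a₂ a₃ b :=
  HCov_of_HMF p hp ends o a₁ a₂ a₃ b
    (HMF_pendant_path ends o a₁ a₂ a₃ b v u p hp hff hf hleaf hf' hdeg hstar h3v hvu h3o h31 h32
      h3b hvo hv1 hv2 hvb hu1 hu2 huo hub)

end PendantPath

end StarH

end Summit.Ventures.PercRepro2
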